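import Literature.AlgebraicGeometry.HodgeTheory.LefschetzOneOneHeartOfCechIntegral
import Literature.AlgebraicGeometry.HodgeTheory.LefschetzOneOneCechIntegrality
import Literature.AlgebraicGeometry.HodgeTheory.CartierDivisorChernClass
import Literature.AlgebraicGeometry.HodgeTheory.GAGALineBundles
import Literature.Geometry.Kaehler.ChernCharacterCocycleIso
import HarnessLib

/-!
# Lefschetz's theorem on `(1,1)`-classes: the analytic form (proved), and the reduction to GAGA for line bundles

Family `hodge`, layer `Literature/AlgebraicGeometry/HodgeTheory`. Proof file for the named fact
`lefschetzOneOne_rational` (`LefschetzOneOne.lean`; Voisin I, Thm. 11.30 with Cor. 11.34 and §11.3.2).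
With the Čech integrality step discharged (`CechCocycleIntegral_holds`, `LefschetzOneOneCechIntegrality`),
the Chern–Weil heart of `LefschetzOneOneHeartOfCechIntegral` is unconditional, and through the Chern
connection of a Hermitian holomorphic line cocycle (`Geometry/Kaehler/HolomorphicLineBundleChernConnection`:
a Chern form of `(L, h)` is a first Chern character form, `ch₁ = c₁`) and the Chern character CLASS
`HodgeModel.chernCharacter` (`ChernCharacterClass`, Chern–Weil I–II proved) it reads:

* `exists_eq_smul_chernCharacter_lineBundle` — **the analytic Lefschetz `(1,1)` theorem, PROVED: on a
  smooth projective `X/ℂ`, every rational class `c ∈ H²(X(ℂ); ℂ)` whose pull-back to a Hodge model `A`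
  lies in `A.hodgePQ 2 1 1` is `a • c₁(L)`, `c₁(L) = A.chernCharacter L.toSmoothCocycle 1`, for ONE
  holomorphic line cocycle `L` on `A.carrier ≅ X^an` and some `a : ℂ`** (Voisin I, Thm. 11.30:
  "`Hdg²(X, ℤ)` is equal to the image of `c₁ : Pic X → H²(X, ℤ)`", tensored with `ℂ`; the scalar
  absorbs the denominator of `c` and the comparison scalar of the model);
* `chernCharacter_mem_algebraicClasses_of_serreGAGA` — granted GAGA for line bundles
  (`serreGAGA_lineCocycle_iso_cartierDivisorCocycle`, `GAGALineBundles`: every holomorphic rank-one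
  cocycle on `X^an` is holomorphically isomorphic to `𝒪_X(D)^an`), `c₁(V)` is an algebraic class for
  every holomorphic rank-one cocycle `V` (isomorphism invariance of the Chern character,
  `CocycleIso.chernCharacterDeRham_eq` with `mk_eq_mk_of_isChernCharacterForm_holds`; and
  `chernCharacter_cartierDivisorCocycle_mem_algebraicClasses'`, Voisin I Thm. 11.33: `c₁(𝒪(D))` is
  supported on `Supp D`);
* `lefschetzOneOne_rational_of_serreGAGA` — **`lefschetzOneOne_rational` from GAGA for line bundles
  ALONE**: the trust base of the named fact is exactly {`serreGAGA_lineCocycle_iso_cartierDivisorCocycle`}.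

The Summits-side twins (route NikulinTwinTransport, item `LefschetzOneOneK3`) are
`Summit.HodgeConjecture.HodgeConjecture.Theorems.exists_eq_smul_chernCharacter_lineBundle` and
`…lefschetzOneOne_rational_of_serreGAGA`; this file makes the discharge expressible inside `Literature/`
(`theorem lefschetzOneOne_rational_holds := lefschetzOneOne_rational_of_serreGAGA serreGAGA_…_holds`, the
day GAGA lands).

## References

* C. Voisin, *Hodge Theory and Complex Algebraic Geometry I* (2002), Thm. 7.10, Thm. 11.30, Thm. 11.33,
  Cor. 11.34, §11.3.2. [VoisinHodgeI2002]
* J.-P. Serre, *GAGA* (1956), n° 20 Prop. 18. [SerreGAGA1956]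
* S. Kobayashi, *Differential Geometry of Complex Vector Bundles* (1987), Ch. II Thm. 2.16. [Kobayashi1987]
-/

noncomputable section

open scoped Manifold ContDiff
open Literature.Geometry.Kaehler
open Literature.NumberTheory.Transcendental
open Literature.AlgebraicTopology.SingularHomology (singularCohomology)

namespace Literature.AlgebraicGeometry.HodgeTheory

section HodgeTheory

variable {n : ℕ} {X : Motives.SchemeOver ℂ}

/-- **The printed heart on every model space, unconditionally**: de Rham's integration comparison,
complexified, is natural and satisfies Lefschetz `(1,1)` in Chern–Weil form (`isLefschetzOneOne_complexify_integration_of_cechIntegral`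
fed with `CechCocycleIntegral_holds`). [cite: VoisinHodgeI2002, Thm. 11.30 and Thm. 7.10 (i)] -/
theorem exists_isNatural_isLefschetzOneOne (E : Type) [NormedAddCommGroup E] [NormedSpace ℂ E]
    [FiniteDimensional ℂ E] : ∃ e₀ : ComplexDeRhamIsoFamily E, e₀.IsNatural ∧ e₀.IsLefschetzOneOne := by
  haveI : FiniteDimensional ℝ E := FiniteDimensional.complexToReal E
  exact ⟨(integrationDeRhamIsoFamily E).complexify,
    DeRhamIsoFamily.complexify_isNatural integrationDeRhamIsoFamily_isNatural,
    isLefschetzOneOne_complexify_integration_of_cechIntegral CechCocycleIntegral_holds E⟩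

/-- **The first Chern class `c₁(L) = A.chernCharacter L.toSmoothCocycle 1` of a holomorphic line cocycle is
computed by any Chern form of any Hermitian metric**: `A.pullback (c₁(L)) = A.deRham[θ]` (Voisin I,
Thm. 7.10 (i); Chern–Weil II, `HodgeModel.pullback_chernCharacter`, with `θ = ch₁(L, D_h)`,
`HermitianMetric.isChernCharacterForm_of_isChernForm`). [cite: VoisinHodgeI2002, Thm. 7.10 (i)]
[cite: Kobayashi1987, Ch. II §2 Thm. 2.16] -/
theorem HodgeModel.pullback_chernCharacter_toSmoothCocycle_of_isChernForm (A : HodgeModel n X) {ι : Type}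
    (L : HolomorphicLineBundle ι A.model A.carrier) (h : L.HermitianMetric)
    (θ : MForm 𝓘(ℝ, A.model) A.carrier ℂ 2) (hs : IsSmoothForm θ) (hc : IsClosedForm θ) (hθ : h.IsChernForm θ) :
    A.pullback (2 * 1) (A.chernCharacter L.toSmoothCocycle 1) =
      A.deRham A.carrier (2 * 1)
        (complexDeRhamCohomology.mk A.model A.carrier (2 * 1) ⟨θ, mem_cclosedSmoothForms hs hc⟩) :=
  A.pullback_chernCharacter L.toSmoothCocycle 1 h.chernConnection hs hc (h.isChernCharacterForm_of_isChernForm hθ)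

/-- **Lefschetz's theorem on `(1,1)`-classes, analytic form (PROVED): a rational `(1,1)`-class is a
complex multiple of the first Chern class of ONE holomorphic line bundle.** For `X` smooth projective
over `ℂ`, a Hodge model `A` and a rational class `c ∈ H²(X(ℂ); ℂ)` with `A.pullback c ∈ A.hodgePQ 2 1 1`,
there are a holomorphic line cocycle `L` on `A.carrier` and `a : ℂ` with
`c = a • A.chernCharacter L.toSmoothCocycle 1`. Proof: `N • c` is integral (universal coefficients,
`exists_nsmul_isIntegralClass_of_isRationalClass_holds`); the heart (`exists_isNatural_isLefschetzOneOne`)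
transported to `A` by rigidity (`lefschetzOneOne_chernWeil_of_rigidity`, `NaturalDeRhamComparisonRigidity_holds`)
gives `A.pullback (N • c) = μ • A.deRham[θ]` for the Chern form `θ` of some `(L, h)`, and
`A.deRham[θ] = A.pullback (c₁(L))`; `A.pullback` is injective. Voisin I, Thm. 11.30 ("`Hdg²(X, ℤ)` is
equal to the image of `c₁ : Pic X → H²(X, ℤ)`"), tensored with `ℂ`. [cite: VoisinHodgeI2002, Thm. 11.30 and Thm. 7.10 (i)] -/
theorem exists_eq_smul_chernCharacter_lineBundle (hX : Motives.IsSmoothProjective n X) (A : HodgeModel n X)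
    (c : complexBetti X (2 * 1)) (hc : IsRationalClass c) (h11 : A.pullback (2 * 1) c ∈ A.hodgePQ (2 * 1) 1 1) :
    ∃ (ι : Type) (L : HolomorphicLineBundle ι A.model A.carrier) (a : ℂ),
      c = a • A.chernCharacter L.toSmoothCocycle 1 := by
  obtain ⟨N, hN, hNc⟩ := exists_nsmul_isIntegralClass_of_isRationalClass_holds hX (2 * 1) c hc
  have hβi : IsIntegralClass (A.pullback (2 * 1) ((N : ℂ) • c)) := hNc.map _
  have hβ11 : A.pullback (2 * 1) ((N : ℂ) • c) ∈ A.hodgePQ (2 * 1) 1 1 := by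
    rw [map_smul]
    exact Submodule.smul_mem _ _ h11
  obtain ⟨ι, L, h, θ, hs, hcl, hθ, μ, hβ⟩ :=
    lefschetzOneOne_chernWeil_of_rigidity NaturalDeRhamComparisonRigidity_holds
      (fun E _ _ _ ↦ exists_isNatural_isLefschetzOneOne E)
      (fun _ _ _ _ _ _ _ _ _ _ _ _ _ _ _ _ ↦ inferInstance) hX A _ hβi hβ11
  have hN' : (N : ℂ) ≠ 0 := by exact_mod_cast hN.ne'
  have hNc' : (N : ℂ) • c = μ • A.chernCharacter L.toSmoothCocycle 1 := A.pullback_injective (2 * 1)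
    (by rw [hβ, map_smul, A.pullback_chernCharacter_toSmoothCocycle_of_isChernForm L h θ hs hcl hθ])
  exact ⟨ι, L, (N : ℂ)⁻¹ * μ, by rw [mul_smul, ← hNc', smul_smul, inv_mul_cancel₀ hN', one_smul]⟩

/-- **Granted GAGA for line bundles, `c₁(V)` is an algebraic class for every holomorphic rank-one cocycle
`V` on `X^an`**: `c₁(V) = c₁(𝒪_X(D)^an)` for the divisor of the fact (isomorphism invariance of the Chern
character, Chern–Weil II; holomorphic isomorphisms are smooth), and `c₁(𝒪_X(D)^an)` is algebraic
(`chernCharacter_cartierDivisorCocycle_mem_algebraicClasses'`). [cite: SerreGAGA1956, n° 20 Prop. 18]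
[cite: VoisinHodgeI2002, Thm. 11.33] -/
theorem chernCharacter_mem_algebraicClasses_of_serreGAGA (hG : serreGAGA_lineCocycle_iso_cartierDivisorCocycle)
    (hX : Motives.IsSmoothProjective n X) (A : HodgeModel n X) {ι : Type}
    (V : SmoothComplexVectorBundle ι A.model A.carrier 1) (hV : V.IsHolomorphic) :
    A.chernCharacter V 1 ∈ algebraicClasses X 1 := by
  letI : AlgebraicGeometry.IsIntegral X.left := Motives.IsSmoothProjective.isIntegral_holds hX
  obtain ⟨D, Φ, hΦ⟩ := hG hX A ι V hV
  have heq : A.chernCharacter V 1 = A.chernCharacter (cartierDivisorCocycle A.isAnalytification D) 1 :=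
    A.pullback_injective (2 * 1) (by
      rw [A.pullback_chernCharacter_eq, A.pullback_chernCharacter_eq,
        SmoothComplexVectorBundle.CocycleIso.chernCharacterDeRham_eq
          (SmoothComplexVectorBundle.mk_eq_mk_of_isChernCharacterForm_holds A.model A.carrier) Φ hΦ.isSmooth 1])
  rw [heq]
  exact chernCharacter_cartierDivisorCocycle_mem_algebraicClasses' A D

/-- **`lefschetzOneOne_rational` (Voisin I, Thm. 11.30 with Cor. 11.34 and §11.3.2) from GAGA for line
bundles ALONE.** [cite: VoisinHodgeI2002, §11.3.2 (remark after Conj. 11.36), Thm. 11.30 and Cor. 11.34]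
[cite: SerreGAGA1956, n° 20 Prop. 18] -/
theorem lefschetzOneOne_rational_of_serreGAGA (hG : serreGAGA_lineCocycle_iso_cartierDivisorCocycle) :
    lefschetzOneOne_rational := by
  intro n X hX c hc h11
  obtain ⟨A, hA⟩ := h11
  obtain ⟨ι, L, a, rfl⟩ := exists_eq_smul_chernCharacter_lineBundle hX A c hc hA
  exact Submodule.smul_mem _ _
    (chernCharacter_mem_algebraicClasses_of_serreGAGA hG hX A L.toSmoothCocycle L.toSmoothCocycle_isHolomorphic)

end HodgeTheory

end Literature.AlgebraicGeometry.HodgeTheory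

end
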